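import Mathlib
import Literature.MathematicalPhysics.StatisticalMechanics.Crystallization
import Summits.AtomisticToContinuum.Crystallization.Theses.ThreeConeCertificate
import Summits.AtomisticToContinuum.Crystallization.Theorems.ThreeConeCertificateExactCertificateTransfer1DClass
import Summits.AtomisticToContinuum.Crystallization.Theorems.ThreeConeCertificateExactCertificateTransfer1DZeroContinuous
import Summits.AtomisticToContinuum.Crystallization.Theorems.ThreeConeCertificateExactCertificateTransfer1DZeroDerivative
import Summits.AtomisticToContinuum.Crystallization.Theorems.ThreeConeCertificateExactCertificateTransfer1DZeroSigns
import Summits.AtomisticToContinuum.Crystallization.Theorems.ThreeConeCertificateExactCertificateTransfer1DZeroCollapse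
import Summits.AtomisticToContinuum.Crystallization.Theorems.ThreeConeCertificateExactCertificateTransfer1DZeroAttain

/-!
# Crux `ExactCertificate` (stmt-AtomisticToContinuum-11959), line `closure-makes-nogap-exact`, lead c9:
# TRANSFER skeleton VII — ZERO PRESSURE EXISTS: the class theorem with hypothesis-minimal input (`OneCrossingChainCrystallizes`)

Skeleton VII v2 (c9, 2026-08-17) — SORRY-FREE: all five registered stubs LANDED in wave 3 (stub_chainEnergyContinuous p158654, stub_zeroPressure_of_isMinOn p158887, stub_chainEnergy_signs p158908, stub_chainEnergy_tendsto_zero_right p159138, stub_exists_isMinOn_of_limits p158693) and are IMPORTED below; the assembly `…Transfer1DZero.lean` (registered `stub_zeroAssembly`) is a separate tree file.  v1:  The 3-D line is parked (skeleton v6; nothing below is a stub of the 3-D crux).  Transfer V proved the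
exact certificate and `HasPeriodicGroundStateEnergy V 1` for every pair potential of the one-crossing Laplace class GIVEN a zero-pressure
spacing `a` (for the Mie family `a` was computed in closed form).  This skeleton removes that hypothesis: zero pressure EXISTS as soon as
the core is repulsive enough (`V(r) ≥ c r⁻²` near `0`) and the potential is attractive somewhere (`V(r₁) < 0`), because the chain energy
`e(b) = Σ_{m≥1} V(mb)` is continuous on `(0,∞)`, tends to `+∞` at `0⁺` and to `0` at `∞`, takes a negative value (one crossing propagates
negativity of `V` to the right), hence attains a negative global minimum at some `a`, where it is differentiable with
`e′(a) = Σ_k (k+1) ∫₀^∞ e^{−t(k+1)a} p(t) t dt = 0` — zero pressure in exactly the moment form Transfer V consumes.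

  `OneCrossingChainCrystallizes` := for every `V(r) = −∫₀^∞ e^{−tr}p(t)dt` with `p` measurable, `≥ 0` on `(0,t₀]`, `≤ 0` on `[t₀,∞)`,
  `|p(t)| ≤ C(t² + t^M)` (`M ≥ 2`), a core bound `c r⁻² ≤ V(r)` on `(0, r₀]` (`c, r₀ > 0`) and a negative value `V(r₁) < 0` (`r₁ > 0`):
  `HasPeriodicGroundStateEnergy V 1`.
-/

noncomputable section

/-! ## The stubs — ALL LANDED (imported; namespace `…Theorems.ThreeConeCertificateExactCertificate.Transfer1D`):
`stub_chainEnergyContinuous` (Z1, p158654), `stub_zeroPressure_of_isMinOn` (Z2, p158887), `stub_chainEnergy_signs` (Z3a, p158908),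
`stub_chainEnergy_tendsto_zero_right` (Z3b, p159138), `stub_exists_isMinOn_of_limits` (Z3c, p158693). -/

namespace Summit.AtomisticToContinuum.Crystallization.Cruxes.ExactCertificate.Transfer1D

open Literature.MathematicalPhysics.StatisticalMechanics MeasureTheory Set Filter Topology
open scoped BigOperators
open Summit.AtomisticToContinuum.Crystallization.Theorems.ThreeConeCertificateExactCertificate.Transfer1D

/-- **The deciding statement of Transfer skeleton VII: ENERGETIC CRYSTALLIZATION OF THE ONE-CROSSING CLASS WITH NO ZERO-PRESSURE INPUT.**
Hypotheses, in order: `p` measurable; `0 < t₀`; `p ≥ 0` on `(0,t₀]`; `p ≤ 0` on `[t₀,∞)`; `2 ≤ M`; envelope `|p(t)| ≤ C(t²+t^M)`; Laplace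
representation `V(r) = −∫₀^∞e^{−tr}p(t)dt` on `(0,∞)`; core `0 < c`, `0 < r₀`, `c r⁻² ≤ V(r)` on `(0,r₀]`; a negative value `0 < r₁`,
`V(r₁) < 0`.  Conclusion: `HasPeriodicGroundStateEnergy V 1`. -/
def OneCrossingChainCrystallizes : Prop :=
  ∀ (V p : ℝ → ℝ) (t₀ C c r₀ r₁ : ℝ) (M : ℕ), Measurable p → 0 < t₀ →
    (∀ t : ℝ, 0 < t → t ≤ t₀ → 0 ≤ p t) → (∀ t : ℝ, t₀ ≤ t → p t ≤ 0) → 2 ≤ M →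
    (∀ t : ℝ, 0 < t → |p t| ≤ C * (t ^ 2 + t ^ M)) →
    (∀ r : ℝ, 0 < r → V r = -(∫ t in Set.Ioi (0 : ℝ), Real.exp (-(t * r)) * p t)) →
    0 < c → 0 < r₀ → (∀ r : ℝ, 0 < r → r ≤ r₀ → c * r⁻¹ ^ 2 ≤ V r) →
    0 < r₁ → V r₁ < 0 →
    HasPeriodicGroundStateEnergy V 1

/-! ## Composition: the stubs close `OneCrossingChainCrystallizes` -/

/-- **ZERO PRESSURE EXISTS, AND THE CLASS CRYSTALLIZES ENERGETICALLY**: composition of the registered stubs with Transfer V's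
`hasPeriodicGroundStateEnergy_one_of_oneCrossing`. -/
theorem OneCrossingChainCrystallizes_of : OneCrossingChainCrystallizes := by
  intro V p t₀ C c r₀ r₁ M hpm ht₀ hpos hneg hM hbd hV hc hr₀ hcore hr₁ hVr₁
  obtain ⟨-, hcont⟩ := stub_chainEnergyContinuous V p C M hM hpm hbd hV
  obtain ⟨-, -, hnegchain, hlim⟩ := stub_chainEnergy_signs V p t₀ C M hpm ht₀ hpos hneg hM hbd hV
  have hzero := stub_chainEnergy_tendsto_zero_right V p C c r₀ M hM hpm hbd hV hc hr₀ hcore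
  obtain ⟨a, ha, hmin⟩ := stub_exists_isMinOn_of_limits (fun b : ℝ => ∑' k : ℕ, V (((k : ℝ) + 1) * b)) hcont hzero hlim
    ⟨r₁, hr₁, hnegchain r₁ hr₁ hVr₁⟩
  have hz := stub_zeroPressure_of_isMinOn V p C a M hM hpm hbd hV ha hmin
  exact hasPeriodicGroundStateEnergy_one_of_oneCrossing hpm ht₀ hpos hneg hM hbd hV ha hz

end Summit.AtomisticToContinuum.Crystallization.Cruxes.ExactCertificate.Transfer1D

end
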